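import Summits.BirchSwinnertonDyer.BirchSwinnertonDyer.Theorems.ByReductionTypeAtTwoRankOneAtTwoBigImageOddLocalOneDoorBottomOfPrint
import Summits.BirchSwinnertonDyer.BirchSwinnertonDyer.Theorems.ByReductionTypeAtTwoRankOneAtTwoBigImageOddLocalOneDoorFullCPrimary
import Summits.BirchSwinnertonDyer.BirchSwinnertonDyer.Theorems.ByReductionTypeAtTwoRankOneAtTwoBigImageOddLocalOneDoorIndexLawOfKolyvaginExact
import Summits.BirchSwinnertonDyer.BirchSwinnertonDyer.Theorems.ByReductionTypeAtTwoRankOneAtTwoBigImageOddLocalOneDoorValue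
import HarnessLib

/-!
# Route ByReductionTypeAtTwo, crux `RankOneAtTwoBigImageOddLocal` (stmt-BirchSwinnertonDyer-23715), LINE v8.12 `one_door_analytic`:
# THE PROVED SUB-SLICE AS ONE THEOREM — `BSD₂(W)` at every BOTTOM-RUNG door, modulo print and rank-`0` `BSD₂` of the twin

Lead prover seat `bsd-line-fkl-p1` g14 (2026-08-28), `--supports stmt-BirchSwinnertonDyer-23715` (helper).  THEOREMS ONLY; no definition,
no named fact introduced, no `sorry`; BSD is not proved by any of this — every statement is CONDITIONAL on PRINT named facts of the tree
(Gross–Zagier, Kolyvagin, modularity, Hoffstein–Luo, Cassels 1962, Gross 1991 Prop. 3.7 (2)) and on rank-`0` `BSD₂` of the twin (a hypothesis,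
or the route's four `…RankZeroAtTwo` cruxes BY NAME).

What thirteen generations of the line proved, stated once.  The crux asks for `BSDp W 2` (Miller's `BSD(E, 2)`) for every non-CM `W/ℚ` of
analytic rank `1` with `ρ_{W,2^n}` onto for all `n`, odd `#E(ℚ)_tors` and odd `∏ c_ℓ`.  The line reads `BSD₂(W)` through ONE door: an
imaginary quadratic `K` with `d_K` door-admissible and `L(W^{(d_K)}, 1) ≠ 0`, a parametrisation datum `Dt`, a Heegner point `P ∈ E(K)`,
a globally minimal model `Wd` of the twist; at such a datum `BSD₂(W)` is EQUIVALENT (modulo print and `BSD₂(Wd)`) to the floating-constant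
index law `2m + [Δ_W<0] = s_W + s_d + t + 2s + 2·v₂(c)` (`bsdp_two_iff_doorLawFullC_at_of_rank`).  The BOTTOM RUNG of that law — a MINIMAL
door (`t + 2s = [Δ_W < 0]`: one error place), an odd constant `c`, and a Heegner point that is NOT `2`-divisible modulo torsion (`m = 0`) —
is Kolyvagin's first `2`-descent over `ℚ`, assembled from print by the tree (`doorIndexLawUpperCAtTwoBottom_of_print`, p658522): there
`Ш(W)[2^∞] = Ш(Wd)[2^∞] = 0`, so the law's identity holds with `m = 0`, and the equivalence gives `BSD₂(W)`.

* `bsdp_two_of_bottomRung_at` — per datum, with `BSDp Wd 2` a hypothesis: PRINT ⁶ + `BSD₂(Wd)` ⟹ `BSD₂(W)`.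
* `bsdp_two_of_bottomRung_at_of_rankZeroTwin` — the same with `BSD₂(Wd)` supplied by rank-`0` `BSD₂` for non-CM curves (`S_rankZeroTwin`).
* `bsdp_two_of_bottomRung_at_of_rankZero_cruxes` — the same with the route's four rank-`0` cruxes at `2` BY NAME.
* `bsdp_two_of_exists_bottomRungDoor` — the SUB-SLICE form: every `W` of the slice that ADMITS a bottom-rung door datum satisfies `BSD₂`,
  modulo print and the four rank-`0` cruxes.  The complement of this sub-slice inside the crux is exactly the line's conjecture-grade residue
  (`DoorIndexLawUpperCAtTwoOffBottom`, `DoorIndexLawLowerCAtTwo`: Kolyvagin exactness at `2` beyond the first layer, and its converse).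

References: [GrossLMS1991] §10 and Prop. 3.7 (2); [Kolyvagin1990] Thm. A; [GrossZagier1986] Thm. I.6.3, V.§2; [Cassels1962]; [Nekovar2007] Prop. 4.9;
[HoffsteinLuo1997]; [KrizLi2019] Cor. 4.2 (the analogous reading of `BSD(2)` over `K` under their Assumption (★)).
-/

set_option autoImplicit false
set_option linter.dupNamespace false

noncomputable section

open scoped Classical

namespace Summit.BirchSwinnertonDyer.BirchSwinnertonDyer.Theorems.RankOneAtTwoOneDoor

open WeierstrassCurve NumberField Literature.NumberTheory.EllipticCurves Literature.NumberTheory.EllipticCurves.ModularForms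
  Summit.BirchSwinnertonDyer.BirchSwinnertonDyer.Theses.ByReductionTypeAtTwo

/-- **`BSD₂(W)` AT A BOTTOM-RUNG DOOR, modulo print and `BSD₂` of the twin.**  `W/ℚ` globally minimal, non-CM, `ρ_{W,2^n}` onto for all `n`,
odd torsion order, odd Tamagawa product, analytic rank `1`; `K` imaginary quadratic with `d_K` door-admissible and `L(W^{(d_K)},1) ≠ 0`; `Dt` a
parametrisation datum of level `N_W` with ODD constant, `H`, `ι`, `P ∈ E(K)` mapping to the complex Heegner point; `Wd` a globally minimal model of
the twist with `BSDp Wd 2`; the door MINIMAL (`t + 2s = [Δ_W < 0]`) and `P ∉ 2E(K) + E(K)_tors` (`HasTwoDivisibilityUpToTorsion W K P 0`).  THEN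
`BSDp W 2` — from Gross–Zagier, Kolyvagin, modularity, Hoffstein–Luo, Cassels–Tate and Gross 1991 Prop. 3.7 (2) (all named facts, taken as
hypotheses): the bottom rung `doorIndexLawUpperCAtTwoBottom_of_print` gives `Ш(W)[2^∞] = Ш(Wd)[2^∞] = 0` (`bottom_conclusion_iff`), whence the
door identity at `m = 0`, whence `BSD₂(W)` by `bsdp_two_iff_doorLawFullC_at_of_rank`.  CONDITIONAL by design; BSD is not proved by this.
[cite: GrossLMS1991, §10 and Prop. 3.7 (2)] [cite: Kolyvagin1990, Thm. A] [cite: GrossZagier1986, Thm. I.6.3 and V.§2] -/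
theorem bsdp_two_of_bottomRung_at
    (hGZ : ∀ (N : ℕ) [NeZero N] (W : WeierstrassCurve ℚ) (K : Type) [Field K] [NumberField K], gross_zagier N W K)
    (hKo : ∀ (N : ℕ) [NeZero N] (W : WeierstrassCurve ℚ) (K : Type) [Field K] [NumberField K], kolyvagin N W K)
    (hnf : exists_isNewformOf) (hHL : HoffsteinLuo1997_exists_twist_L_one_ne_zero)
    (hCT : exists_casselsTate_pairing (K := ℚ))
    (h37 : Literature.NumberTheory.EllipticCurves.GrossLMS1991.prop37_2_frobeniusCongruence)
    (W : WeierstrassCurve ℚ) [W.IsElliptic] [W.IsGloballyMinimal] [NeZero (W.conductorNorm ℤ)]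
    (hCM : ¬ W.HasCM) (hsurj : ∀ n : ℕ, W.HasSurjectiveModNGaloisRep ((2 ^ n : ℕ) : ℤ)) (hT : Odd W.torsionOrder)
    (hc : Odd W.tamagawaProduct) (hr : W.analyticRank = 1)
    (K : Type) [Field K] [NumberField K] (hK : IsImaginaryQuadratic K) (hadm : DoorAdmissible W (NumberField.discr K))
    (hLt : (W.quadraticTwist (NumberField.discr K : ℚ)).entireLFunction 1 ≠ 0)
    (Dt : ModularParametrizationData W (W.conductorNorm ℤ)) (H : HeegnerDatum (W.conductorNorm ℤ) (NumberField.discr K))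
    (ι : K →+* ℂ) (P : (W.baseChange K).toAffine.Point)
    (hP : WeierstrassCurve.Affine.Point.map ι.toRatAlgHom P = heegnerPointComplex Dt H)
    (Wd : WeierstrassCurve ℚ) [Wd.IsElliptic] [Wd.IsGloballyMinimal] (Cd : WeierstrassCurve.VariableChange ℚ)
    (hWd : Cd • W.quadraticTwist (NumberField.discr K : ℚ) = Wd)
    (hmin : transpCount W (NumberField.discr K) + 2 * identCount W (NumberField.discr K) = (if W.Δ < 0 then 1 else 0))
    (hodd : Odd Dt.c) (hm0 : HasTwoDivisibilityUpToTorsion W K P 0) (hBd : BSDp Wd 2) :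
    BSDp W 2 := by
  haveI : Fact (Nat.Prime 2) := ⟨Nat.prime_two⟩
  -- the bottom rung U₀ from print, at this datum
  have hU0 := doorIndexLawUpperCAtTwoBottom_of_print hGZ hKo hnf hHL hCT h37 W hCM hsurj hT hc hr K hK hadm hLt Dt H ι P hP Wd Cd
    hWd hmin hodd hm0
  obtain ⟨hsW, hsd⟩ := (bottom_conclusion_iff W (NumberField.discr K) Dt.c _ _ hmin hodd).mp hU0
  -- the per-datum equivalence `BSD₂(W) ↔ law`, read from right to left at `m = 0`
  have hmod : hasEntireLFunction_rat := hasEntireLFunction_rat_of_exists_isNewformOf hnf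
  have hrk : W.mordellWeilRank = 1 :=
    (mordellWeilRank_eq_one_of_analyticRank_eq_one_of_isGloballyMinimal hGZ hKo hnf hHL W hr).1
  have hHN : SatisfiesHeegnerHypothesis (W.conductorNorm ℤ) K := satisfiesHeegnerHypothesis_of_doorAdmissible W K hK hadm
  obtain ⟨-, -, hiff⟩ :=
    bsdp_two_iff_doorLawFullC_at_of_rank hmod doorTwistTamagawaAtTwo W hT hc hr hrk K hK (hGZ _ W K) (hKo _ W K) hadm hHN hLt
      Dt H ι P hP Wd Cd hWd hBd
  refine hiff.mpr ⟨0, hm0, ?_⟩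
  have hc2 : ¬ (2 : ℤ) ∣ Dt.c := fun h => Int.not_even_iff_odd.mpr hodd (even_iff_two_dvd.mpr h)
  rw [hsW, hsd, padicValInt.eq_zero_of_not_dvd hc2]
  by_cases hΔ : W.Δ < 0
  · rw [if_pos hΔ] at hmin ⊢; omega
  · rw [if_neg hΔ] at hmin ⊢; omega

/-- **`BSD₂(W)` at a bottom-rung door, the twin's `BSD₂` supplied by rank-`0` `BSD₂` for non-CM curves** (`S_rankZeroTwin`): the twist model
`Wd` is non-CM (`j`-invariance) of analytic rank `0` (`L(Wd, 1) = L(W^{(d_K)}, 1) ≠ 0`).  CONDITIONAL by design; BSD is not proved by this.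
[cite: GrossLMS1991, §10] [cite: Kolyvagin1990, Thm. A] -/
theorem bsdp_two_of_bottomRung_at_of_rankZeroTwin
    (hGZ : ∀ (N : ℕ) [NeZero N] (W : WeierstrassCurve ℚ) (K : Type) [Field K] [NumberField K], gross_zagier N W K)
    (hKo : ∀ (N : ℕ) [NeZero N] (W : WeierstrassCurve ℚ) (K : Type) [Field K] [NumberField K], kolyvagin N W K)
    (hnf : exists_isNewformOf) (hHL : HoffsteinLuo1997_exists_twist_L_one_ne_zero)
    (hCT : exists_casselsTate_pairing (K := ℚ))
    (h37 : Literature.NumberTheory.EllipticCurves.GrossLMS1991.prop37_2_frobeniusCongruence)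
    (hZ : S_rankZeroTwin)
    (W : WeierstrassCurve ℚ) [W.IsElliptic] [W.IsGloballyMinimal] [NeZero (W.conductorNorm ℤ)]
    (hCM : ¬ W.HasCM) (hsurj : ∀ n : ℕ, W.HasSurjectiveModNGaloisRep ((2 ^ n : ℕ) : ℤ)) (hT : Odd W.torsionOrder)
    (hc : Odd W.tamagawaProduct) (hr : W.analyticRank = 1)
    (K : Type) [Field K] [NumberField K] (hK : IsImaginaryQuadratic K) (hadm : DoorAdmissible W (NumberField.discr K))
    (hLt : (W.quadraticTwist (NumberField.discr K : ℚ)).entireLFunction 1 ≠ 0)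
    (Dt : ModularParametrizationData W (W.conductorNorm ℤ)) (H : HeegnerDatum (W.conductorNorm ℤ) (NumberField.discr K))
    (ι : K →+* ℂ) (P : (W.baseChange K).toAffine.Point)
    (hP : WeierstrassCurve.Affine.Point.map ι.toRatAlgHom P = heegnerPointComplex Dt H)
    (Wd : WeierstrassCurve ℚ) [Wd.IsElliptic] [Wd.IsGloballyMinimal] (Cd : WeierstrassCurve.VariableChange ℚ)
    (hWd : Cd • W.quadraticTwist (NumberField.discr K : ℚ) = Wd)
    (hmin : transpCount W (NumberField.discr K) + 2 * identCount W (NumberField.discr K) = (if W.Δ < 0 then 1 else 0))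
    (hodd : Odd Dt.c) (hm0 : HasTwoDivisibilityUpToTorsion W K P 0) :
    BSDp W 2 := by
  have hmod : hasEntireLFunction_rat := hasEntireLFunction_rat_of_exists_isNewformOf hnf
  have hD0 : (NumberField.discr K : ℚ) ≠ 0 := by exact_mod_cast NumberField.discr_ne_zero K
  haveI hEt : (W.quadraticTwist (NumberField.discr K : ℚ)).IsElliptic := W.isElliptic_quadraticTwist hD0
  have hCMd : ¬ Wd.HasCM := RamifiedPairUpperBound.not_hasCM_of_smul_quadraticTwist_eq hD0 hWd hCM
  have hLeq : Wd.entireLFunction = (W.quadraticTwist (NumberField.discr K : ℚ)).entireLFunction := by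
    rw [← hWd, entireLFunction_smul]
  have hrd : Wd.analyticRank = 0 :=
    (Wd.analyticRank_eq_zero_iff_holds (hmod Wd)).2 (by rw [hLeq]; exact hLt)
  exact bsdp_two_of_bottomRung_at hGZ hKo hnf hHL hCT h37 W hCM hsurj hT hc hr K hK hadm hLt Dt H ι P hP Wd Cd hWd hmin hodd hm0
    (hZ Wd hCMd hrd)

/-- **`BSD₂(W)` at a bottom-rung door, the twin's `BSD₂` supplied by the route's four rank-`0` cruxes at `2` BY NAME**
(`GoodOrdinaryRankZeroAtTwo`, `MultiplicativeRankZeroAtTwo`, `SupersingularRankZeroAtTwo`, `AdditiveRankZeroAtTwo`, through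
`bsdp_two_of_rankZero_cruxes`).  CONDITIONAL by design; BSD is not proved by this. [cite: GrossLMS1991, §10] [cite: Kolyvagin1990, Thm. A] -/
theorem bsdp_two_of_bottomRung_at_of_rankZero_cruxes
    (hGZ : ∀ (N : ℕ) [NeZero N] (W : WeierstrassCurve ℚ) (K : Type) [Field K] [NumberField K], gross_zagier N W K)
    (hKo : ∀ (N : ℕ) [NeZero N] (W : WeierstrassCurve ℚ) (K : Type) [Field K] [NumberField K], kolyvagin N W K)
    (hnf : exists_isNewformOf) (hHL : HoffsteinLuo1997_exists_twist_L_one_ne_zero)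
    (hCT : exists_casselsTate_pairing (K := ℚ))
    (h37 : Literature.NumberTheory.EllipticCurves.GrossLMS1991.prop37_2_frobeniusCongruence)
    (hZ4 : GoodOrdinaryRankZeroAtTwo ∧ MultiplicativeRankZeroAtTwo ∧ SupersingularRankZeroAtTwo ∧ AdditiveRankZeroAtTwo)
    (W : WeierstrassCurve ℚ) [W.IsElliptic] [W.IsGloballyMinimal] [NeZero (W.conductorNorm ℤ)]
    (hCM : ¬ W.HasCM) (hsurj : ∀ n : ℕ, W.HasSurjectiveModNGaloisRep ((2 ^ n : ℕ) : ℤ)) (hT : Odd W.torsionOrder)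
    (hc : Odd W.tamagawaProduct) (hr : W.analyticRank = 1)
    (K : Type) [Field K] [NumberField K] (hK : IsImaginaryQuadratic K) (hadm : DoorAdmissible W (NumberField.discr K))
    (hLt : (W.quadraticTwist (NumberField.discr K : ℚ)).entireLFunction 1 ≠ 0)
    (Dt : ModularParametrizationData W (W.conductorNorm ℤ)) (H : HeegnerDatum (W.conductorNorm ℤ) (NumberField.discr K))
    (ι : K →+* ℂ) (P : (W.baseChange K).toAffine.Point)
    (hP : WeierstrassCurve.Affine.Point.map ι.toRatAlgHom P = heegnerPointComplex Dt H)
    (Wd : WeierstrassCurve ℚ) [Wd.IsElliptic] [Wd.IsGloballyMinimal] (Cd : WeierstrassCurve.VariableChange ℚ)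
    (hWd : Cd • W.quadraticTwist (NumberField.discr K : ℚ) = Wd)
    (hmin : transpCount W (NumberField.discr K) + 2 * identCount W (NumberField.discr K) = (if W.Δ < 0 then 1 else 0))
    (hodd : Odd Dt.c) (hm0 : HasTwoDivisibilityUpToTorsion W K P 0) :
    BSDp W 2 :=
  bsdp_two_of_bottomRung_at_of_rankZeroTwin hGZ hKo hnf hHL hCT h37
    (fun V _ _ hVCM hV0 => bsdp_two_of_rankZero_cruxes hZ4 V hVCM hV0)
    W hCM hsurj hT hc hr K hK hadm hLt Dt H ι P hP Wd Cd hWd hmin hodd hm0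

/-- **THE PROVED SUB-SLICE OF THE CRUX `RankOneAtTwoBigImageOddLocal`.**  For every `W/ℚ` of the crux's slice (globally minimal, non-CM,
`ρ_{W,2^n}` onto for all `n`, odd torsion order, odd Tamagawa product, analytic rank `1`) that ADMITS A BOTTOM-RUNG DOOR DATUM — an imaginary
quadratic `K` with `d_K` door-admissible, `L(W^{(d_K)}, 1) ≠ 0` and the door minimal (`t + 2s = [Δ_W < 0]`), a parametrisation datum of level
`N_W` with odd constant, a Heegner point `P ∈ E(K)` over it that is not `2`-divisible modulo torsion, and a globally minimal model of the twist —
`BSDp W 2` holds, CONDITIONALLY on the six PRINT named facts (Gross–Zagier, Kolyvagin, modularity, Hoffstein–Luo, Cassels 1962, Gross 1991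
Prop. 3.7 (2)) and on the route's four rank-`0` cruxes at `2` BY NAME.  The crux minus this sub-slice is the line's conjecture-grade residue
(`DoorIndexLawUpperCAtTwoOffBottom`, `DoorIndexLawLowerCAtTwo`).  BSD is not proved by this. [cite: GrossLMS1991, §10 and Prop. 3.7 (2)]
[cite: Kolyvagin1990, Thm. A] [cite: GrossZagier1986, Thm. I.6.3 and V.§2] [cite: KrizLi2019, Cor. 4.2] -/
theorem bsdp_two_of_exists_bottomRungDoor
    (hGZ : ∀ (N : ℕ) [NeZero N] (W : WeierstrassCurve ℚ) (K : Type) [Field K] [NumberField K], gross_zagier N W K)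
    (hKo : ∀ (N : ℕ) [NeZero N] (W : WeierstrassCurve ℚ) (K : Type) [Field K] [NumberField K], kolyvagin N W K)
    (hnf : exists_isNewformOf) (hHL : HoffsteinLuo1997_exists_twist_L_one_ne_zero)
    (hCT : exists_casselsTate_pairing (K := ℚ))
    (h37 : Literature.NumberTheory.EllipticCurves.GrossLMS1991.prop37_2_frobeniusCongruence)
    (hZ4 : GoodOrdinaryRankZeroAtTwo ∧ MultiplicativeRankZeroAtTwo ∧ SupersingularRankZeroAtTwo ∧ AdditiveRankZeroAtTwo)
    (W : WeierstrassCurve ℚ) [W.IsElliptic] [W.IsGloballyMinimal] [NeZero (W.conductorNorm ℤ)]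
    (hCM : ¬ W.HasCM) (hsurj : ∀ n : ℕ, W.HasSurjectiveModNGaloisRep ((2 ^ n : ℕ) : ℤ)) (hT : Odd W.torsionOrder)
    (hc : Odd W.tamagawaProduct) (hr : W.analyticRank = 1)
    (hdoor : ∃ (K : Type) (_ : Field K) (_ : NumberField K), IsImaginaryQuadratic K ∧ DoorAdmissible W (NumberField.discr K) ∧
      (W.quadraticTwist (NumberField.discr K : ℚ)).entireLFunction 1 ≠ 0 ∧
      transpCount W (NumberField.discr K) + 2 * identCount W (NumberField.discr K) = (if W.Δ < 0 then 1 else 0) ∧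
      ∃ (Dt : ModularParametrizationData W (W.conductorNorm ℤ)) (H : HeegnerDatum (W.conductorNorm ℤ) (NumberField.discr K))
        (ι : K →+* ℂ) (P : (W.baseChange K).toAffine.Point) (Wd : WeierstrassCurve ℚ) (_ : Wd.IsElliptic) (_ : Wd.IsGloballyMinimal)
        (Cd : WeierstrassCurve.VariableChange ℚ),
        WeierstrassCurve.Affine.Point.map ι.toRatAlgHom P = heegnerPointComplex Dt H ∧
          Cd • W.quadraticTwist (NumberField.discr K : ℚ) = Wd ∧ Odd Dt.c ∧ HasTwoDivisibilityUpToTorsion W K P 0) :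
    BSDp W 2 := by
  obtain ⟨K, _, _, hK, hadm, hLt, hmin, Dt, H, ι, P, Wd, _, _, Cd, hP, hWd, hodd, hm0⟩ := hdoor
  exact bsdp_two_of_bottomRung_at_of_rankZero_cruxes hGZ hKo hnf hHL hCT h37 hZ4 W hCM hsurj hT hc hr K hK hadm hLt Dt H ι P hP Wd Cd
    hWd hmin hodd hm0

end Summit.BirchSwinnertonDyer.BirchSwinnertonDyer.Theorems.RankOneAtTwoOneDoor

end
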